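import Literature.Computability.QuantumAlgorithms.TrotterErrorFirstOrder
import HarnessLib

/-!
# `r` Trotter steps for `Γ` summands (first and second order)

Topic `Literature/Computability/QuantumAlgorithms`. instance-level adjudication of specific advantage
claims; no claim about BQP vs BPP or the summit.

Companion to `TrotterErrorFirstOrder.lean` (Childs–Su–Tran–Wiebe–Zhu 2021, §5.1 Propositions 11–12
in contraction form for a LIST of summands: `TrotterError.norm_lieTrotterOne_sub_exp_le`,
`TrotterError.norm_strang_sub_exp_le`). Here the one-step bounds are combined with the telescoping
estimate of §2.2, “`‖𝒮^r(t/r) − e^{tH}‖ ≤ r‖𝒮(t/r) − e^{(t/r)H}‖`” (valid because every factor is a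
contraction), giving the `r`-step forms with the printed `1/r` resp. `1/r²` gain:
* `TrotterError.norm_lieTrotterOne_pow_sub_exp_le` —
  `‖𝒮₁(t/r)^r − e^{tΣx_γ}‖ ≤ (t²/(2r)) Σ_{γ₁}‖[Σ_{γ₂>γ₁}x_{γ₂}, x_{γ₁}]‖`;
* `TrotterError.norm_strang_pow_sub_exp_le` —
  `‖𝒮₂(t/r)^r − e^{tΣ(x_γ+x_γ)}‖ ≤ (t³/(6r²))·secondOrderCommSum`
  (= `(t³/(12r²))Σ‖[Σ_{>γ}H,[Σ_{>γ}H,H_γ]]‖ + (t³/(24r²))Σ‖[H_γ,[H_γ,Σ_{>γ}H]]‖` for `x_γ = −iH_γ/2`);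
with the contraction lemmas `norm_lieTrotterOne_le_one`, `norm_strang_le_one`.

## What is NOT here
Higher orders (`p ≥ 3`) and anything about a particular Hamiltonian.

## References
* A. M. Childs, Y. Su, M. C. Tran, N. Wiebe, S. Zhu, *Theory of Trotter error with commutator
  scaling*, Phys. Rev. X 11, 011020 (2021) = arXiv:1912.08854, §2.2 (Trotter number, error
  accumulation over `r` steps) and §5.1 Propositions 11–12 [ChildsSuTranWiebeZhu2021].
-/

noncomputable section

namespace Literature.Computability.QuantumAlgorithms

open NormedSpace Set

namespace TrotterError

variable {𝔸 : Type*} [NormedRing 𝔸] [NormedAlgebra ℝ 𝔸] [CompleteSpace 𝔸]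

omit [NormedAlgebra ℝ 𝔸] [CompleteSpace 𝔸] in
/-- Norm of an element between two contractions (plumbing). [folklore] -/
private theorem norm_conj_le' {P Q c : 𝔸} (hP : ‖P‖ ≤ 1) (hQ : ‖Q‖ ≤ 1) : ‖P * c * Q‖ ≤ ‖c‖ :=
  calc ‖P * c * Q‖ ≤ ‖P‖ * ‖c‖ * ‖Q‖ :=
      (norm_mul_le _ _).trans (mul_le_mul_of_nonneg_right (norm_mul_le _ _) (norm_nonneg _))
    _ ≤ 1 * ‖c‖ * 1 := by gcongr
    _ = ‖c‖ := by ring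

/-- `e^{t z} = (e^{(t/(n+1)) z})^{n+1}` (plumbing). [folklore] -/
private theorem exp_smul_eq_pow (z : 𝔸) (t : ℝ) (n : ℕ) :
    exp (t • z) = exp ((t / (n + 1)) • z) ^ (n + 1) := by
  letI : NormedAlgebra ℚ 𝔸 := NormedAlgebra.restrictScalars ℚ ℝ 𝔸
  rw [← exp_nsmul, ← Nat.cast_smul_eq_nsmul ℝ, smul_smul]
  congr 1
  push_cast
  field_simp

/-! ### First order -/

omit [CompleteSpace 𝔸] in
/-- `𝒮₁(t)` is a contraction when every factor is. [cite: ChildsSuTranWiebeZhu2021, §2.2] -/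
theorem norm_lieTrotterOne_le_one [NormOneClass 𝔸] (t : ℝ) :
    ∀ xs : List 𝔸, (∀ x ∈ xs, ‖exp (t • x)‖ ≤ 1) → ‖lieTrotterOne t xs‖ ≤ 1
  | [], _ => by simp
  | x :: rest, h => by
    rw [lieTrotterOne_cons]
    have h1 := norm_lieTrotterOne_le_one t rest (fun y hy => h y (List.mem_cons_of_mem x hy))
    have h2 := h x List.mem_cons_self
    exact (norm_mul_le _ _).trans
      (by nlinarith [norm_nonneg (lieTrotterOne t rest), norm_nonneg (exp (t • x))])

/-- **Proposition 11 with `r` Trotter steps**: under the hypotheses of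
`norm_lieTrotterOne_sub_exp_le` on `[0, t]`, for `r = n + 1`,
`‖𝒮₁(t/r)^r − e^{tΣx_γ}‖ ≤ (t²/(2r)) Σ_{γ₁}‖[Σ_{γ₂>γ₁}x_{γ₂}, x_{γ₁}]‖`
(“`‖𝒮^r(t/r) − e^{tH}‖ ≤ r‖𝒮(t/r) − e^{(t/r)H}‖`”, then the one-step bound at `t/r`).
[cite: ChildsSuTranWiebeZhu2021, §2.2 (error accumulation over r steps) and §5.1 Proposition 11] -/
theorem norm_lieTrotterOne_pow_sub_exp_le [NormOneClass 𝔸] (t : ℝ) (ht : 0 ≤ t) (xs : List 𝔸)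
    (hel : ∀ x ∈ xs, ∀ s ∈ Icc (0 : ℝ) t, ‖exp (s • x)‖ ≤ 1)
    (hsuf : ∀ zs : List 𝔸, zs <:+ xs → ∀ s ∈ Icc (0 : ℝ) t, ‖exp (s • zs.sum)‖ ≤ 1) (n : ℕ) :
    ‖lieTrotterOne (t / (n + 1)) xs ^ (n + 1) - exp (t • xs.sum)‖ ≤
      t ^ 2 / (2 * (n + 1)) * firstOrderCommSum xs := by
  have hn : (0 : ℝ) < n + 1 := by positivity
  have hτ0 : 0 ≤ t / (n + 1) := div_nonneg ht hn.le
  have hτt : t / (n + 1) ≤ t := div_le_self ht (by linarith)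
  have hsub : ∀ s ∈ Icc (0 : ℝ) (t / (n + 1)), s ∈ Icc (0 : ℝ) t :=
    fun s hs => ⟨hs.1, hs.2.trans hτt⟩
  have hstep := norm_lieTrotterOne_sub_exp_le (t / (n + 1)) hτ0 xs
    (fun x hx s hs => hel x hx s (hsub s hs)) (fun zs hzs s hs => hsuf zs hzs s (hsub s hs))
  have hX : ‖lieTrotterOne (t / (n + 1)) xs‖ ≤ 1 :=
    norm_lieTrotterOne_le_one _ xs (fun x hx => hel x hx _ ⟨hτ0, hτt⟩)
  have hY : ‖exp ((t / (n + 1)) • xs.sum)‖ ≤ 1 := hsuf xs (List.suffix_refl _) _ ⟨hτ0, hτt⟩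
  rw [exp_smul_eq_pow xs.sum t n]
  have htel := Literature.MathematicalPhysics.QuantumLattice.norm_pow_sub_pow_le'
    (lieTrotterOne (t / (n + 1)) xs) (exp ((t / (n + 1)) • xs.sum)) hX hY n
  rw [one_pow, mul_one] at htel
  calc ‖lieTrotterOne (t / (n + 1)) xs ^ (n + 1) - exp ((t / (n + 1)) • xs.sum) ^ (n + 1)‖
      ≤ (n + 1) * ‖lieTrotterOne (t / (n + 1)) xs - exp ((t / (n + 1)) • xs.sum)‖ := htel
    _ ≤ (n + 1) * ((t / (n + 1)) ^ 2 / 2 * firstOrderCommSum xs) := by gcongr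
    _ = t ^ 2 / (2 * (n + 1)) * firstOrderCommSum xs := by field_simp

/-! ### Second order -/

omit [CompleteSpace 𝔸] in
/-- `𝒮₂(t)` is a contraction when every factor is. [cite: ChildsSuTranWiebeZhu2021, §2.2] -/
theorem norm_strang_le_one [NormOneClass 𝔸] (t : ℝ) :
    ∀ xs : List 𝔸, (∀ x ∈ xs, ‖exp (t • x)‖ ≤ 1) → ‖strang t xs‖ ≤ 1
  | [], _ => by simp
  | x :: rest, h => by
    rw [strang_cons]
    exact (norm_conj_le' (h x List.mem_cons_self) (h x List.mem_cons_self)).trans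
      (norm_strang_le_one t rest (fun y hy => h y (List.mem_cons_of_mem x hy)))

/-- **Proposition 12 with `r` Trotter steps**: under the hypotheses of `norm_strang_sub_exp_le` on
`[0, t]`, for `r = n + 1`, `‖𝒮₂(t/r)^r − e^{tΣ(x_γ+x_γ)}‖ ≤ (t³/(6r²))·secondOrderCommSum`
(= `(t³/(12r²))Σ‖[Σ_{>γ}H,[Σ_{>γ}H,H_γ]]‖ + (t³/(24r²))Σ‖[H_γ,[H_γ,Σ_{>γ}H]]‖` for `x_γ = −iH_γ/2`).
[cite: ChildsSuTranWiebeZhu2021, §2.2 (error accumulation over r steps) and §5.1 Proposition 12] -/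
theorem norm_strang_pow_sub_exp_le [NormOneClass 𝔸] (t : ℝ) (ht : 0 ≤ t) (xs : List 𝔸)
    (hel : ∀ x ∈ xs, ∀ s ∈ Icc (0 : ℝ) t, ‖exp (s • x)‖ ≤ 1 ∧ ‖exp ((-s) • x)‖ ≤ 1)
    (hsuf : ∀ zs : List 𝔸, zs <:+ xs → ∀ s ∈ Icc (0 : ℝ) t,
      ‖exp (s • doubleSum zs)‖ ≤ 1 ∧ ‖exp ((-s) • doubleSum zs)‖ ≤ 1) (n : ℕ) :
    ‖strang (t / (n + 1)) xs ^ (n + 1) - exp (t • doubleSum xs)‖ ≤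
      t ^ 3 / (6 * (n + 1) ^ 2) * secondOrderCommSum xs := by
  have hn : (0 : ℝ) < n + 1 := by positivity
  have hτ0 : 0 ≤ t / (n + 1) := div_nonneg ht hn.le
  have hτt : t / (n + 1) ≤ t := div_le_self ht (by linarith)
  have hsub : ∀ s ∈ Icc (0 : ℝ) (t / (n + 1)), s ∈ Icc (0 : ℝ) t :=
    fun s hs => ⟨hs.1, hs.2.trans hτt⟩
  have hstep := norm_strang_sub_exp_le (t / (n + 1)) hτ0 xs
    (fun x hx s hs => hel x hx s (hsub s hs)) (fun zs hzs s hs => hsuf zs hzs s (hsub s hs))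
  have hX : ‖strang (t / (n + 1)) xs‖ ≤ 1 :=
    norm_strang_le_one _ xs (fun x hx => (hel x hx _ ⟨hτ0, hτt⟩).1)
  have hY : ‖exp ((t / (n + 1)) • doubleSum xs)‖ ≤ 1 :=
    (hsuf xs (List.suffix_refl _) _ ⟨hτ0, hτt⟩).1
  rw [exp_smul_eq_pow (doubleSum xs) t n]
  have htel := Literature.MathematicalPhysics.QuantumLattice.norm_pow_sub_pow_le'
    (strang (t / (n + 1)) xs) (exp ((t / (n + 1)) • doubleSum xs)) hX hY n
  rw [one_pow, mul_one] at htel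
  calc ‖strang (t / (n + 1)) xs ^ (n + 1) - exp ((t / (n + 1)) • doubleSum xs) ^ (n + 1)‖
      ≤ (n + 1) * ‖strang (t / (n + 1)) xs - exp ((t / (n + 1)) • doubleSum xs)‖ := htel
    _ ≤ (n + 1) * ((t / (n + 1)) ^ 3 / 6 * secondOrderCommSum xs) := by gcongr
    _ = t ^ 3 / (6 * (n + 1) ^ 2) * secondOrderCommSum xs := by field_simp

end TrotterError

end Literature.Computability.QuantumAlgorithms
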